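import Mathlib
import Literature.NumberTheory.Transcendental.KZCalculusProofs
import Literature.NumberTheory.Transcendental.KZLogCalculusProofs

/-!
# Stub `stub_logRectSweep` — crux `OffTetraSectorKernel`, line `odd-hyperbolic-ladder` (skeleton v9)

Stub `stub_logRectSweep` of the crux `OffTetraSectorKernel` (stmt-KontsevichZagierPeriods-10557,
route HyperbolicBloch). In the proof of Abel's five-term equation of the real dilogarithm as
Kontsevich–Zagier moves, the logarithmic side `log P₁ · log Q₁` is the log RECTANGLE
`M = [(1, P₁) × (1, Q₁), 1/(u w)]` with `P₁ = (1 − xy)/(1 − x)`, `Q₁ = (1 − xy)/(1 − y)`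
(`0 < x, y < 1` real algebraic), and "integration by parts" is done geometrically: the curve
`y' ↦ (P(y'), Q(y')) = ((1 − xy')/(1 − x), (1 − xy')/(1 − y'))` sweeps the region
`R = {1 < w < Q₁, 1 < u < w/(w − x)}` (`P(Q⁻¹(w)) = w/(w − x)`), written without division as
`R = {1 < u, u (w − x) < w, 1 < w < Q₁}`, and `R` is EXACTLY (not only almost everywhere) the
disjoint union of `M` and of the curvilinear triangle `S = R ∩ {u ≥ P₁}`.

This file is that ONE domain-additivity move (KZ rule (1a), `KZ.domainAddRel`): for
representations `M`, `R`, `S` on these three domains whose integrands agree with `1/(u w)` on their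
domains, `[R] − [M] − [S] ∈ KZ.relations`. The only computation is the elementary inequality
`logRectSweep_mul_sub_lt`: for `u < P₁` and `1 < w < Q₁` one has `u (w − x) < w`, because
`P₁ (w − x) ≤ w ⇔ w ≤ P₁ x/(P₁ − 1) = Q₁`; together with `1 < P₁` it gives `M ⊆ R`, `S ⊆ R`,
`R = M ∪ S` (case split on `u < P₁`) and `M ∩ S = ∅`.

References: M. Kontsevich, D. Zagier, *Periods* (2001), §1.2 rule (1). No definitions are
introduced.
-/

noncomputable section

open Set MeasureTheory
open Literature.NumberTheory.Transcendental Literature.ModelTheory.ExponentialFields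

namespace Summit.KontsevichZagierPeriods.HyperbolicBloch.OffTetraSectorKernel

/-- **The sweep inequality.** For `0 < x < 1`, `y < 1`, `a < P₁ = (1 − xy)/(1 − x)` and
`1 < b < Q₁ = (1 − xy)/(1 − y)` one has `a (b − x) < b`: indeed `a (b − x) < P₁ (b − x)` and
`P₁ (b − x) ≤ b ⇔ b (P₁ − 1) ≤ P₁ x ⇔ b ≤ Q₁` (`P₁ − 1 = x (1 − y)/(1 − x) > 0`,
`P₁ x/(P₁ − 1) = Q₁`). Cleared of denominators: `a (1 − x)(b − x) < (1 − xy)(b − x)` and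
`b (1 − x) − (1 − xy)(b − x) = x ((1 − xy) − b (1 − y)) > 0`. [folklore] -/
theorem logRectSweep_mul_sub_lt {x y a b : ℝ} (hx0 : 0 < x) (hx1 : x < 1) (hy1 : y < 1)
    (ha : a < (1 - x * y) / (1 - x)) (hb1 : 1 < b) (hb : b < (1 - x * y) / (1 - y)) :
    a * (b - x) < b := by
  have hx1' : 0 < 1 - x := sub_pos.mpr hx1
  have hy1' : 0 < 1 - y := sub_pos.mpr hy1
  rw [lt_div_iff₀ hx1'] at ha
  rw [lt_div_iff₀ hy1'] at hb
  have hbx : 0 < b - x := by linarith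
  have key : a * (b - x) * (1 - x) < b * (1 - x) := by
    nlinarith [mul_lt_mul_of_pos_right ha hbx, mul_pos hx0 (sub_pos.mpr hb)]
  exact lt_of_mul_lt_mul_right key hx1'.le

/-- For `0 < x < 1` and `y < 1` the corner `P₁ = (1 − xy)/(1 − x)` of the log rectangle exceeds
`1`: `1 − x < 1 − xy ⇔ 0 < x (1 − y)`. [folklore] -/
theorem logRectSweep_one_lt_div {x y : ℝ} (hx0 : 0 < x) (hx1 : x < 1) (hy1 : y < 1) :
    1 < (1 - x * y) / (1 - x) := by
  rw [one_lt_div (sub_pos.mpr hx1)]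
  nlinarith [mul_pos hx0 (sub_pos.mpr hy1)]

/-- **Stub `stub_logRectSweep`** (rule (1a), ONE move — the rectangle swept by the curve
`y ↦ (P(y), Q(y))`, `P(y) = (1 − xy)/(1 − x)` decreasing, `Q(y) = (1 − xy)/(1 − y)` increasing,
`P(Q⁻¹(w)) = w/(w − x)`): the region `R = {1 < w < Q(y), 1 < u < w/(w − x)}` is the disjoint
union of the log rectangle `M = (1, P(y)) × (1, Q(y))` and of the curvilinear triangle
`S = R ∩ {u ≥ P(y)}` (exactly, not only a.e.), and the three integrands agree with `1/(u w)` on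
their domains; hence `[R] − [M] − [S]` is a single domain-additivity move
(`KZ.domainAddRel ⊆ KZ.relations`). [cite: KontsevichZagier2001, §1.2 rule (1)] -/
theorem stub_logRectSweep :
    ∀ (x y : ℝ), IsAlgebraic ℚ x → IsAlgebraic ℚ y → 0 < x → x < 1 → 0 < y → y < 1 →
    ∀ (M R S : KZ.IntegralRep 2),
      M.domain = {w | 1 < w 0 ∧ w 0 < (1 - x * y) / (1 - x) ∧ 1 < w 1 ∧ w 1 < (1 - x * y) / (1 - y)} →
      Set.EqOn M.integrand (fun w => 1 / (w 0 * w 1)) M.domain →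
      R.domain = {w | 1 < w 0 ∧ w 0 * (w 1 - x) < w 1 ∧ 1 < w 1 ∧ w 1 < (1 - x * y) / (1 - y)} →
      Set.EqOn R.integrand (fun w => 1 / (w 0 * w 1)) R.domain →
      S.domain = {w | (1 - x * y) / (1 - x) ≤ w 0 ∧ w 0 * (w 1 - x) < w 1 ∧ 1 < w 1 ∧
        w 1 < (1 - x * y) / (1 - y)} →
      Set.EqOn S.integrand (fun w => 1 / (w 0 * w 1)) S.domain →
      KZ.of R - KZ.of M - KZ.of S ∈ KZ.relations := by
  intro x y _ _ hx0 hx1 _ hy1 M R S hM hMi hR hRi hS hSi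
  -- `M ⊆ R`: the sweep inequality
  have hMR : M.domain ⊆ R.domain := by
    intro w hw
    rw [hM] at hw
    rw [hR]
    obtain ⟨h0, h0p, h1, h1q⟩ := hw
    exact ⟨h0, logRectSweep_mul_sub_lt hx0 hx1 hy1 h0p h1 h1q, h1, h1q⟩
  -- `S ⊆ R`: `1 < P₁ ≤ u`
  have hSR : S.domain ⊆ R.domain := by
    intro w hw
    rw [hS] at hw
    rw [hR]
    obtain ⟨h0p, h01, h1, h1q⟩ := hw
    exact ⟨(logRectSweep_one_lt_div hx0 hx1 hy1).trans_le h0p, h01, h1, h1q⟩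
  -- `R = M ∪ S`: case split on `u < P₁`
  have hunion : R.domain = M.domain ∪ S.domain := by
    refine Subset.antisymm ?_ (union_subset hMR hSR)
    intro w hw
    rw [hR] at hw
    obtain ⟨h0, h01, h1, h1q⟩ := hw
    rcases lt_or_ge (w 0) ((1 - x * y) / (1 - x)) with h0p | h0p
    · left
      rw [hM]
      exact ⟨h0, h0p, h1, h1q⟩
    · right
      rw [hS]
      exact ⟨h0p, h01, h1, h1q⟩
  -- `M ∩ S = ∅`
  have hinter : M.domain ∩ S.domain = ∅ := by
    ext w
    simp only [mem_inter_iff, mem_empty_iff_false, iff_false, not_and]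
    intro hwM hwS
    rw [hM] at hwM
    rw [hS] at hwS
    obtain ⟨-, h0p, -, -⟩ := hwM
    obtain ⟨h0p', -, -, -⟩ := hwS
    exact absurd h0p (not_lt.mpr h0p')
  -- the integrands agree with that of `R` on `M` and on `S`
  have hRM : EqOn R.integrand M.integrand M.domain := fun w hw => by
    rw [hRi (hMR hw), hMi hw]
  have hRS : EqOn R.integrand S.integrand S.domain := fun w hw => by
    rw [hRi (hSR hw), hSi hw]
  exact KZ.domainAddRel_subset_relations
    ⟨2, R, M, S, hunion, by rw [hinter, measure_empty], hRM, hRS, rfl⟩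

end Summit.KontsevichZagierPeriods.HyperbolicBloch.OffTetraSectorKernel
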